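import Mathlib
import HarnessLib
import Literature.Analysis.FluidPDE.SelfSimilar
import Literature.Analysis.FluidPDE.LocalTypeI
import Literature.Analysis.FluidPDE.VectorCalculus
import Literature.Analysis.FluidPDE.OseenMildUniqueness
import Literature.Analysis.Fourier.TitchmarshPaleyWiener
import Literature.Analysis.UnboundedOperators.HeatKernel
import Summits.NavierStokesRegularity.NavierStokesRegularity.Theorems.LocalSineTubeDoorProfileAlignedWindowRigidityAncient
import Summits.NavierStokesRegularity.NavierStokesRegularity.Theorems.PoloidalWindowDoorPoloidalWindowRigiditySubparabolicGradient
import Summits.NavierStokesRegularity.NavierStokesRegularity.Theorems.PoloidalWindowDoorPoloidalWindowRigidityLinePairing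
import Summits.NavierStokesRegularity.NavierStokesRegularity.Theorems.PoloidalWindowDoorPoloidalWindowRigidityLineBandLimited

/-!
# K2 `PoloidalWindowRigidity` (stmt-NavierStokesRegularity-19708) — POINTWISE BAND-LIMITATION ALONG ONE DIRECTION ON A
# WINDOW ALREADY RULES OUT A SINGULAR APEX (Baire upgrade of the endgame of the rung `stub_expTypeTH`, line `entire_slices`)

Seat ns-es-p1 g3 (`--supports stmt-NavierStokesRegularity-19708 --as helper`).  The landed endgame
`…Theorems.PoloidalWindowDoorPoloidalWindowRigidityHorizontalExpType.not_backwardSingular_of_lineExpType` (g2, p609770) asks for a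
UNIFORM exponential-type bound `|g⁽ⁿ⁾(0)| ≤ A bⁿ` (one `A`, one `b`) for the line restrictions `g(s) = v_i(t, y + s e₀)` at all
points `(t,y)` of an open space–time window, along the coordinate direction `e₀ = (1,0,0)`.  Both restrictions are removed here:

* `exists_open_uniform_band` — BAIRE STEP: if at every point `(t,y)` of a nonempty open `W ⊆ (−∞,0) × ℝ³` each line restriction
  `s ↦ v_i(t, y + s e)` (fixed direction `e`, any) has distributional Fourier support in SOME bounded interval `[−B, B]`,
  `B = B(t,y,i)`, then on a nonempty open `W₁ ⊆ W` one integer band `[−N, N]` serves every point and every component.  (The sets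
  `H_N = Wᶜ ∪ {z ∈ W : supp ⊆ [−N,N] for all i}` are closed — their defining conditions are zero sets of the line pairings
  `z ↦ ∫ v_i(z.1, z.2 + s e) 𝓕φ(s) ds`, continuous on the slab by `…LinePairing.analyticOnNhd_linePairing` — and cover `ℝ × ℝ³`;
  Baire's theorem `dense_iUnion_interior_of_closed` in the complete metric space `ℝ × ℝ³` gives an `H_N` with interior meeting `W`.)
* `not_backwardSingular_of_lineBandLimited_pointwise` — Type-I class profile + such a window ⇒ `¬ IsBackwardSingularPoint v 0`
  (Baire step, then the g2 chain: propagation `…LinePairing.hasFourierSupportIn_line_of_open` (C) → Bernstein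
  `…LineBandLimited.norm_fderiv_apply_le_of_lineBandLimited_typeI` (B) → `…SubparabolicGradient.not_backwardSingular_of_fderiv_apply_bound` (A)).
* `not_backwardSingular_of_lineExpType_pointwise` — the same with the Taylor-coefficient phrasing: at each window point each line
  restriction satisfies `|g⁽ⁿ⁾(0)| ≤ A bⁿ` for all `n` with ITS OWN `A, b` (no sign conditions; i.e. `g` is entire of finite
  exponential type), via `…LineBandLimited.hasFourierSupportIn_of_iteratedDeriv_bound` (D).
* `not_backwardSingular_of_horizontalExpType_pointwise` — the 2-D horizontal phrasing of the stubs of `entire_slices`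
  (`‖Dⁿ[p ↦ v(t, y + (p₀,p₁,0))](0)‖ ≤ A bⁿ`, point-dependent `A, b`), via `…LineBandLimited.hasFourierSupportIn_line_of_taylorBound`.

So the weakest natural form of the rung's mechanism reads: «if on SOME open space–time set every line restriction of every component
along ONE fixed direction is an entire function of finite exponential type (equivalently, by Paley–Wiener–Schwartz for bounded
functions, band-limited), the apex is regular» — no uniformity, no coordinate direction, no (TH)/twist/pin structure.

WHAT THIS IS NOT: not a claim about Navier–Stokes regularity and not the crux K2 — a class-level endgame (Liouville-type statement about
HYPOTHETICAL Type-I ancient mild profiles); bears_on LADDER-NS N0 via crux K2 = stmt-19708, line `entire_slices`.  No summit statement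
is proved here.
-/

noncomputable section

-- the summit and its single sub-problem share the name (CONVENTIONS §1), as in every Theorems file
set_option linter.dupNamespace false

namespace Summit.NavierStokesRegularity.NavierStokesRegularity.Theorems.PoloidalWindowDoorPoloidalWindowRigidityLineExpTypePointwise

open Set Function Filter MeasureTheory Metric Topology
open scoped Real FourierTransform SchwartzMap
open Literature.Analysis Literature.Analysis.FluidPDE Literature.Analysis.Fourier
open Summit.NavierStokesRegularity.NavierStokesRegularity.Theorems.LocalSineTubeDoorProfileAlignedWindowRigidityAncient
open Summit.NavierStokesRegularity.NavierStokesRegularity.Theorems.PoloidalWindowDoorPoloidalWindowRigiditySubparabolicGradient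
open Summit.NavierStokesRegularity.NavierStokesRegularity.Theorems.PoloidalWindowDoorPoloidalWindowRigidityLinePairing
open Summit.NavierStokesRegularity.NavierStokesRegularity.Theorems.PoloidalWindowDoorPoloidalWindowRigidityLineBandLimited

variable {C : ℝ} {v : ℝ → EuclideanSpace ℝ (Fin 3) → EuclideanSpace ℝ (Fin 3)}

/-! ### The Baire step -/

/-- **Pointwise band-limitation on a window is uniform on a sub-window (Baire).**  Let `v` be Oseen-ancient (continuous on the
open slab, bounded on every `(−∞,−δ)`, unit-viscosity Oseen-mild), `e ∈ ℝ³`, and `W ⊆ (−∞,0) × ℝ³` nonempty open such that at every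
`(t,y) ∈ W` each line restriction `s ↦ v_i(t, y + s e)` has distributional Fourier support in some `[−B, B]` (`B` depending on the
point and the component).  Then there are a nonempty open `W₁ ⊆ W` and `N ∈ ℕ` with Fourier support in `[−N, N]` for every point of
`W₁` and every component.  Proof: Baire category in `ℝ × ℝ³` for the closed cover `H_N = Wᶜ ∪ {supp ⊆ [−N,N]}` (closed because the
line pairings against `𝓕φ` are continuous on the slab, `analyticOnNhd_linePairing`). -/
theorem exists_open_uniform_band
    (hcont : ContinuousOn (uncurry v) (Iio (0 : ℝ) ×ˢ univ))
    (hbdd : ∀ δ : ℝ, 0 < δ → ∃ B : ℝ, ∀ t < -δ, ∀ y : EuclideanSpace ℝ (Fin 3), ‖v t y‖ ≤ B)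
    (hmild : ∀ s t : ℝ, s < t → t < 0 → ∀ y : EuclideanSpace ℝ (Fin 3),
      v t y = UnboundedOperators.heatExtension (v s) (t - s) y - oseenDuhamel 1 s v v t y)
    (e : EuclideanSpace ℝ (Fin 3))
    {W : Set (ℝ × EuclideanSpace ℝ (Fin 3))} (hW : IsOpen W) (hWne : W.Nonempty)
    (hWs : W ⊆ Iio (0 : ℝ) ×ˢ univ)
    (hK : ∀ z ∈ W, ∀ i : Fin 3, ∃ B : ℝ,
      HasFourierSupportIn (fun s : ℝ => ((v z.1 (z.2 + s • e) i : ℝ) : ℂ)) (Icc (-B) B)) :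
    ∃ W₁ : Set (ℝ × EuclideanSpace ℝ (Fin 3)), W₁ ⊆ W ∧ IsOpen W₁ ∧ W₁.Nonempty ∧ ∃ N : ℕ,
      ∀ z ∈ W₁, ∀ i : Fin 3,
        HasFourierSupportIn (fun s : ℝ => ((v z.1 (z.2 + s • e) i : ℝ) : ℂ)) (Icc (-(N : ℝ)) N) := by
  classical
  -- the line pairings against `𝓕φ` are continuous on the slab
  have hΦc : ∀ (i : Fin 3) (φ : 𝓢(ℝ, ℂ)),
      ContinuousOn (fun q : ℝ × EuclideanSpace ℝ (Fin 3) =>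
        ∫ s, ((v q.1 (q.2 + s • e) i : ℝ) : ℂ) * 𝓕 (φ : ℝ → ℂ) s) (Iio (0 : ℝ) ×ˢ univ) := by
    intro i φ
    have hψ : Integrable (𝓕 (φ : ℝ → ℂ)) := by
      rw [← SchwartzMap.fourier_coe]; exact (𝓕 φ).integrable
    exact (analyticOnNhd_linePairing hcont hbdd hmild e i hψ).continuousOn
  have hslab : IsOpen (Iio (0 : ℝ) ×ˢ (univ : Set (EuclideanSpace ℝ (Fin 3)))) :=
    isOpen_Iio.prod isOpen_univ
  -- the closed cover
  set H : ℕ → Set (ℝ × EuclideanSpace ℝ (Fin 3)) := fun N =>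
    {z | z ∈ W → ∀ i : Fin 3,
      HasFourierSupportIn (fun s : ℝ => ((v z.1 (z.2 + s • e) i : ℝ) : ℂ)) (Icc (-(N : ℝ)) N)} with hH
  have hHc : ∀ N, IsClosed (H N) := by
    intro N
    rw [← isOpen_compl_iff, isOpen_iff_mem_nhds]
    intro z hz
    have hzW : z ∈ W := by
      by_contra h
      exact hz fun hzW => absurd hzW h
    have hfail : ∃ i : Fin 3,
        ¬ HasFourierSupportIn (fun s : ℝ => ((v z.1 (z.2 + s • e) i : ℝ) : ℂ)) (Icc (-(N : ℝ)) N) := by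
      by_contra h
      push Not at h
      exact hz fun _ => h
    obtain ⟨i, hi⟩ := hfail
    rw [hasFourierSupportIn_iff] at hi
    push Not at hi
    obtain ⟨φ, hφ, hne⟩ := hi
    have hcz : ContinuousAt (fun q : ℝ × EuclideanSpace ℝ (Fin 3) =>
        ∫ s, ((v q.1 (q.2 + s • e) i : ℝ) : ℂ) * 𝓕 (φ : ℝ → ℂ) s) z :=
      (hΦc i φ).continuousAt (hslab.mem_nhds (hWs hzW))
    filter_upwards [hcz.eventually_ne hne, hW.mem_nhds hzW] with q hq hqW
    intro hqH
    exact hq (hqH hqW i φ hφ)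
  have hHU : (⋃ N, H N) = univ := by
    refine eq_univ_of_forall fun z => ?_
    by_cases hzW : z ∈ W
    · choose B hB using hK z hzW
      obtain ⟨N, hN⟩ := exists_nat_ge (∑ j, |B j|)
      have hBi : ∀ i, B i ≤ (N : ℝ) := fun i =>
        ((le_abs_self _).trans
          (Finset.single_le_sum (fun j _ => abs_nonneg (B j)) (Finset.mem_univ i))).trans hN
      exact mem_iUnion.2 ⟨N, fun _ i => (hB i).mono (Icc_subset_Icc (neg_le_neg (hBi i)) (hBi i))⟩
    · exact mem_iUnion.2 ⟨0, fun h => absurd h hzW⟩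
  -- Baire: some `H_N` has interior meeting `W`
  have hdense : Dense (⋃ N, interior (H N)) := dense_iUnion_interior_of_closed hHc hHU
  obtain ⟨z₀, hz₀, hz₀W⟩ := hdense.exists_mem_open hW hWne
  obtain ⟨N, hN⟩ := mem_iUnion.1 hz₀
  refine ⟨W ∩ interior (H N), inter_subset_left, hW.inter isOpen_interior, ⟨z₀, hz₀W, hN⟩, N, ?_⟩
  intro z hz i
  exact interior_subset hz.2 hz.1 i

/-! ### The endgame, pointwise forms -/

/-- **POINTWISE BAND-LIMITATION ALONG ONE DIRECTION ON A WINDOW ⇒ REGULAR APEX.**  Let `v` be a profile of the Type-I class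
(rate `‖v(t,x)‖ ≤ C/√(−t)`, continuity on the open slab, unit-viscosity Oseen-mild identity, divergence-free slices), `e ≠ 0`, and
`W ⊆ (−∞,0) × ℝ³` nonempty open such that at every `(t,y) ∈ W` every line restriction `s ↦ v_i(t, y + s e)` is band-limited
(Fourier support in some bounded `[−B, B]`, `B = B(t,y,i)` free).  Then `(0,0)` is not a backward singular point of `v`. -/
theorem not_backwardSingular_of_lineBandLimited_pointwise (hrate : HasTypeITimeDecay C v)
    (hcont : ContinuousOn (uncurry v) (Iio (0 : ℝ) ×ˢ univ))
    (hmild : ∀ s t : ℝ, s < t → t < 0 → ∀ x,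
      v t x = UnboundedOperators.heatExtension (v s) (t - s) x - oseenDuhamel 1 s v v t x)
    (hdiv : ∀ t < 0, VectorCalculus.IsDivFree (v t))
    {e : EuclideanSpace ℝ (Fin 3)} (he : e ≠ 0)
    {W : Set (ℝ × EuclideanSpace ℝ (Fin 3))} (hW : IsOpen W) (hWne : W.Nonempty) (hWs : W ⊆ Iio (0 : ℝ) ×ˢ univ)
    (hK : ∀ z ∈ W, ∀ i : Fin 3, ∃ B : ℝ,
      HasFourierSupportIn (fun s : ℝ => ((v z.1 (z.2 + s • e) i : ℝ) : ℂ)) (Icc (-B) B)) :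
    ¬ IsBackwardSingularPoint v 0 := by
  have hbdd := bdd_of_hasTypeITimeDecay hrate
  obtain ⟨W₁, hW₁W, hW₁o, hW₁ne, N, hN⟩ := exists_open_uniform_band hcont hbdd hmild e hW hWne hWs hK
  -- (C) propagation, (B) Bernstein, (A) endgame
  have hC : ∀ t < 0, ∀ (y : EuclideanSpace ℝ (Fin 3)) (i : Fin 3),
      HasFourierSupportIn (fun s : ℝ => ((v t (y + s • e) i : ℝ) : ℂ)) (Icc (-(N : ℝ)) N) :=
    fun t ht y i => hasFourierSupportIn_line_of_open hcont hbdd hmild e i _ hW₁o hW₁ne (hW₁W.trans hWs)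
      (fun z hz => hN z hz i) t ht y
  have hB := norm_fderiv_apply_le_of_lineBandLimited_typeI hrate hcont hmild (e := e) (B := (N : ℝ))
    (Nat.cast_nonneg N) hC
  exact not_backwardSingular_of_fderiv_apply_bound hrate hcont hmild hdiv he hB

/-- **POINTWISE FINITE EXPONENTIAL TYPE ALONG ONE DIRECTION ON A WINDOW ⇒ REGULAR APEX.**  Same class, `e ≠ 0`, `W` nonempty
open in the slab; hypothesis: at every `(t,y) ∈ W`, for every component `i`, the (real-analytic) line restriction
`g(s) = v_i(t, y + s e)` satisfies `|g⁽ⁿ⁾(0)| ≤ A bⁿ` for all `n` with constants `A, b` depending on the point and the component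
(no sign conditions) — i.e. `g` extends to an entire function of finite exponential type.  Then `¬ IsBackwardSingularPoint v 0`. -/
theorem not_backwardSingular_of_lineExpType_pointwise (hrate : HasTypeITimeDecay C v)
    (hcont : ContinuousOn (uncurry v) (Iio (0 : ℝ) ×ˢ univ))
    (hmild : ∀ s t : ℝ, s < t → t < 0 → ∀ x,
      v t x = UnboundedOperators.heatExtension (v s) (t - s) x - oseenDuhamel 1 s v v t x)
    (hdiv : ∀ t < 0, VectorCalculus.IsDivFree (v t))
    {e : EuclideanSpace ℝ (Fin 3)} (he : e ≠ 0)
    {W : Set (ℝ × EuclideanSpace ℝ (Fin 3))} (hW : IsOpen W) (hWne : W.Nonempty) (hWs : W ⊆ Iio (0 : ℝ) ×ˢ univ)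
    (hA : ∀ z ∈ W, ∀ i : Fin 3, ∃ A b : ℝ, ∀ n : ℕ,
      |iteratedDeriv n (fun s : ℝ => v z.1 (z.2 + s • e) i) 0| ≤ A * b ^ n) :
    ¬ IsBackwardSingularPoint v 0 := by
  have hbdd := bdd_of_hasTypeITimeDecay hrate
  refine not_backwardSingular_of_lineBandLimited_pointwise hrate hcont hmild hdiv he hW hWne hWs fun z hz i => ?_
  obtain ⟨A, b, hAb⟩ := hA z hz i
  have ht : z.1 < 0 := (mem_prod.1 (hWs hz)).1
  have hAn : AnalyticOnNhd ℝ (v z.1) univ := analyticOnNhd_slice hcont hbdd hmild ht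
  obtain ⟨Bt, hBt⟩ := hbdd (-(z.1 / 2)) (by linarith)
  have hgan : AnalyticOnNhd ℝ (fun s : ℝ => v z.1 (z.2 + s • e) i) univ := fun s _ =>
    ((EuclideanSpace.proj (𝕜 := ℝ) i : EuclideanSpace ℝ (Fin 3) →L[ℝ] ℝ).analyticAt _).comp
      ((hAn _ (mem_univ _)).comp (analyticAt_line z.2 e s))
  have hgM : ∀ x : ℝ, |v z.1 (z.2 + x • e) i| ≤ Bt := fun x => by
    have h := PiLp.norm_apply_le (v z.1 (z.2 + x • e)) i
    rw [Real.norm_eq_abs] at h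
    exact h.trans (hBt z.1 (by linarith) _)
  have hA' : ∀ n : ℕ, |iteratedDeriv n (fun s : ℝ => v z.1 (z.2 + s • e) i) 0| ≤ |A| * |b| ^ n := fun n =>
    (hAb n).trans (by rw [← abs_pow, ← abs_mul]; exact le_abs_self _)
  exact ⟨_, hasFourierSupportIn_of_iteratedDeriv_bound hgan (abs_nonneg b) hA' hgM⟩

/-- **POINTWISE HORIZONTAL EXPONENTIAL TYPE ON A WINDOW ⇒ REGULAR APEX** (the 2-D phrasing of the stubs of `entire_slices`, with
point-dependent constants): same class, `W` nonempty open in the slab, and at every `(t,y) ∈ W` the horizontal restriction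
`p ↦ v(t, y + (p₀, p₁, 0))` satisfies `‖Dⁿ(·)(0)‖ ≤ A bⁿ` for all `n`, with `A = A(t,y)`, `b = b(t,y)` (no sign conditions).  Then
`¬ IsBackwardSingularPoint v 0`. -/
theorem not_backwardSingular_of_horizontalExpType_pointwise (hrate : HasTypeITimeDecay C v)
    (hcont : ContinuousOn (uncurry v) (Iio (0 : ℝ) ×ˢ univ))
    (hmild : ∀ s t : ℝ, s < t → t < 0 → ∀ x,
      v t x = UnboundedOperators.heatExtension (v s) (t - s) x - oseenDuhamel 1 s v v t x)
    (hdiv : ∀ t < 0, VectorCalculus.IsDivFree (v t))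
    {W : Set (ℝ × EuclideanSpace ℝ (Fin 3))} (hW : IsOpen W) (hWne : W.Nonempty) (hWs : W ⊆ Iio (0 : ℝ) ×ˢ univ)
    (hA : ∀ z ∈ W, ∃ A b : ℝ, ∀ n : ℕ, ‖iteratedFDeriv ℝ n (fun p : EuclideanSpace ℝ (Fin 2) =>
        v z.1 (z.2 + (EuclideanSpace.single 0 (p 0) + EuclideanSpace.single 1 (p 1)))) 0‖ ≤ A * b ^ n) :
    ¬ IsBackwardSingularPoint v 0 := by
  have hbdd := bdd_of_hasTypeITimeDecay hrate
  set e₀ : EuclideanSpace ℝ (Fin 3) := EuclideanSpace.single 0 1 with he₀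
  have he₀0 : e₀ ≠ 0 := by
    intro h
    have h0 := congrArg (fun w : EuclideanSpace ℝ (Fin 3) => w 0) h
    simp [he₀] at h0
  refine not_backwardSingular_of_lineBandLimited_pointwise hrate hcont hmild hdiv he₀0 hW hWne hWs fun z hz i => ?_
  obtain ⟨A, b, hAb⟩ := hA z hz
  have hA' : ∀ n : ℕ, ‖iteratedFDeriv ℝ n (fun p : EuclideanSpace ℝ (Fin 2) =>
      v z.1 (z.2 + (EuclideanSpace.single 0 (p 0) + EuclideanSpace.single 1 (p 1)))) 0‖ ≤ |A| * |b| ^ n := fun n =>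
    (hAb n).trans (by rw [← abs_pow, ← abs_mul]; exact le_abs_self _)
  exact ⟨_, hasFourierSupportIn_line_of_taylorBound hcont hbdd hmild (mem_prod.1 (hWs hz)).1 z.2 (abs_nonneg b) hA' i⟩

end Summit.NavierStokesRegularity.NavierStokesRegularity.Theorems.PoloidalWindowDoorPoloidalWindowRigidityLineExpTypePointwise

end
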